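import Literature.Analysis.FluidPDE.HardSphereCollisionRecordMeasurable
import Literature.Analysis.FluidPDE.HardSphereFlowJointMeasurable
import Summits.AtomisticToContinuum.HydrodynamicLimit.Theorems.OneFlightGossipEngineEquilibriumClampedCollisionalWindowLDCoinTimesC1

/-!
# Coins are measurable, II: the flow, records and clamps read at a coin; marks, ranges and the coin filtration
(crux `EquilibriumClampedCollisionalWindowLD`, stmt-AtomisticToContinuum-13733; line `coarse-coin-entropy-chain`;
stub `stub_compensatorDefectLD` (S5), layers L2–L4 — registered sub-goals `compensatorDefect_flowAtCoin_measurable`,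
`compensatorDefect_coinMark_measurable`, `compensatorDefect_coinRange_measurable`, `compensatorDefect_coinFiltration_exists`)

Support file (`--supports stmt-AtomisticToContinuum-13733`), continuing `…WindowLDCoinTimesC1` (L1: the coin count and
the guarded coin times are measurable in the datum; coin decomposition of collision sums). No new definitions: every
object is read ON THE GUARD EVENT `{z ∈ good ∧ n < coinCount}` of the `n`-th coin, as a function on that subtype.

* L2 · `compensatorDefect_flowAtCoin_measurable`: the configuration AT the `n`-th coin, `z ↦ Φ.flow (coinTime Φ z n) z`,
  is measurable on the guard event — JOINT measurability of the torus flow on its good set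
  (`HardSphereFlow.measurable_flow_prod_torus`) composed with the measurable coin time of L1; more generally at every
  earlier coin `m ≤ n` (`measurable_flow_coinTime_guard`), with the coin times (`measurable_coinTime_guard`) and the
  records of the ordered pairs (`measurable_record_guard`, `HardSphereCollisionRecord.measurable_ofConfig₂_torus`);
  the finite-sum engine `measurable_sum_contactPairs_of_measurable` (sums over the ordered contact pairs of a
  measurable configuration-valued map; `measurableSet_contactSet`); the running TRANSFER activities at the `n`-th coin
  time are finite coin sums over `m ≤ n` / `m < n` (`runAct_coinTime_eq_sum`, `preAct_coinTime_eq_sum`, by the coin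
  decomposition of L1), hence measurable on the guard event with the adapted / predictable clamps
  (`measurable_runAct_coinTime_guard`, `measurable_preAct_coinTime_guard`, `measurable_flagA_coinTime_guard`,
  `measurable_flagP_coinTime_guard`);
* L3 · guarded coin sums `1_{guard} Σ_{ordered contact pairs at coin n} (clamp)(clamp) F(record)` are measurable on
  the ambient σ-algebra for every measurable functional `F` of the record (`measurable_coinSumA` adapted clamps,
  `measurable_coinSumP` predictable clamps; `measurable_ite_of_restrict`); the MARK `coinMark` and the TRUNCATED
  PREDICTABLE RANGE `coinRange` are of this form by definition (`coinMark_eq_ite`, `coinRange_eq_ite`,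
  `measurable_payload`, `measurable_rangeBase`), whence the registered sub-goals `compensatorDefect_coinMark_measurable`,
  `compensatorDefect_coinRange_measurable`;
* L4 · `compensatorDefect_coinFiltration_exists`: THE NATURAL COIN FILTRATION — `ℱ n` generated by the ranges
  `coinRange … r m`, `m ≤ n`, and the marks `coinMark … r m`, `m < n`, of all rows `r` (the information revealed
  strictly before the impact parameter of the `n`-th coin is drawn, in the bookkeeping of the line) — is a filtration
  of the ambient σ-algebra by L3, along which the marks are adapted (`coinMark … r n` is `ℱ (n+1)`-measurable) and the
  ranges predictable (`coinRange … r n` is `ℱ n`-measurable) BY CONSTRUCTION: the first two conjuncts of S5 for this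
  `ℱ` (constructed inside the proof; no definition). This is the cheapest legitimate witness (S5 quantifies `∃ ℱ`);
  the large-deviation content of S5 is then entirely in its last conjunct.
-/

noncomputable section

open MeasureTheory ProbabilityTheory Set Filter
open scoped ENNReal BigOperators
open Literature.Analysis.FluidPDE Literature.MathematicalPhysics.KineticTheory
open Literature.Analysis.FunctionSpaces (Torus.partialDeriv Torus.IsSmooth)

namespace Summit.AtomisticToContinuum.HydrodynamicLimit.Theorems.ClampedTransferCoin

variable {σ : ℝ} {N : ℕ}

/-! ## L2 · the flow, the coin times and the records on the guard event of a coin -/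

/-- On the guard event of the `n`-th coin, the time of every coin `m ≤ n` is measurable. -/
theorem measurable_coinTime_guard (hσ : 0 < σ) (hσ2 : σ < 1 / 2) (τ : ℝ) (Φ : Flow σ N) {m n : ℕ} (hmn : m ≤ n) :
    Measurable fun z : {z : Phase N // z ∈ Φ.good ∧ n < coinCount σ τ Φ z} => coinTime Φ z.1 m := by
  have heq : (fun z : {z : Phase N // z ∈ Φ.good ∧ n < coinCount σ τ Φ z} => coinTime Φ z.1 m) =
      fun z => (Φ.good.indicator fun z => if m < coinCount σ τ Φ z then coinTime Φ z m else 0) z.1 := by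
    funext z
    rw [Set.indicator_of_mem z.2.1, if_pos (lt_of_le_of_lt hmn z.2.2)]
  rw [heq]
  exact (compensatorDefect_coinTime_measurable hσ hσ2 τ N Φ m).comp measurable_subtype_coe

/-- On the guard event of the `n`-th coin, the configuration at every coin `m ≤ n` is measurable (joint measurability
of the flow on the good set). -/
theorem measurable_flow_coinTime_guard (hσ : 0 < σ) (hσ2 : σ < 1 / 2) (τ : ℝ) (Φ : Flow σ N) {m n : ℕ}
    (hmn : m ≤ n) :
    Measurable fun z : {z : Phase N // z ∈ Φ.good ∧ n < coinCount σ τ Φ z} => Φ.flow (coinTime Φ z.1 m) z.1 := by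
  have hmk : Measurable fun z : {z : Phase N // z ∈ Φ.good ∧ n < coinCount σ τ Φ z} =>
      ((⟨z.1, z.2.1⟩ : Φ.good), coinTime Φ z.1 m) :=
    (measurable_subtype_coe.subtype_mk).prodMk (measurable_coinTime_guard hσ hσ2 τ Φ hmn)
  exact Φ.measurable_flow_prod_torus.comp hmk

/-- **L2 · the configuration at the `n`-th coin is measurable in the datum** on the event
`{z ∈ good | n < coinCount}` (registered sub-goal of `stub_compensatorDefectLD`). -/
theorem compensatorDefect_flowAtCoin_measurable {σ : ℝ} (hσ : 0 < σ) (hσ2 : σ < 1 / 2) (τ : ℝ) (N : ℕ)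
    (Φ : Flow σ N) (n : ℕ) :
    Measurable fun z : {z : Phase N // z ∈ Φ.good ∧ n < coinCount σ τ Φ z} => Φ.flow (coinTime Φ z.1 n) z.1 :=
  measurable_flow_coinTime_guard hσ hσ2 τ Φ le_rfl

/-- On the guard event of the `n`-th coin, the record of the ordered pair `(i, j)` at every coin `m ≤ n` is measurable
(records carry the product σ-algebra of `HardSphereCollisionRecordMeasurable`). -/
theorem measurable_record_guard (hσ : 0 < σ) (hσ2 : σ < 1 / 2) (τ : ℝ) (Φ : Flow σ N) {m n : ℕ} (hmn : m ≤ n)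
    (i j : Fin (N + 1)) :
    Measurable fun z : {z : Phase N // z ∈ Φ.good ∧ n < coinCount σ τ Φ z} =>
      HardSphereCollisionRecord.ofConfig (Torus.geometry (Fin 3)) (hsDiameter σ N) (Φ.flow (coinTime Φ z.1 m) z.1)
        (coinTime Φ z.1 m) i j :=
  (HardSphereCollisionRecord.measurable_ofConfig₂_torus (hsDiameter σ N) i j).comp
    ((measurable_coinTime_guard hσ hσ2 τ Φ hmn).prodMk (measurable_flow_coinTime_guard hσ hσ2 τ Φ hmn))

/-- **Sums over the ordered contact pairs of a measurable configuration-valued map are measurable** (summands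
measurable for each fixed pair; the contact events are measurable, `measurableSet_contactSet`). -/
theorem measurable_sum_contactPairs_of_measurable {α : Type*} [MeasurableSpace α] {E : Type*} [AddCommMonoid E]
    [MeasurableSpace E] [MeasurableAdd₂ E] {Y : α → Phase N} (hY : Measurable Y)
    {g : α → Fin (N + 1) × Fin (N + 1) → E} (hg : ∀ p, Measurable fun a => g a p) :
    Measurable fun a => ∑ p ∈ contactPairs (Torus.geometry (Fin 3)) (hsDiameter σ N) (Y a), g a p := by
  classical
  have hrw : ∀ a, ∑ p ∈ contactPairs (Torus.geometry (Fin 3)) (hsDiameter σ N) (Y a), g a p =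
      ∑ p : Fin (N + 1) × Fin (N + 1), if p.1 ≠ p.2 ∧
        Y a ∈ contactSet (Torus.geometry (Fin 3)) (N + 1) (hsDiameter σ N) p.1 p.2 then g a p else 0 := by
    intro a
    rw [contactPairs, Finset.sum_filter]
  simp_rw [hrw]
  refine Finset.measurable_sum _ fun p _ => Measurable.ite ?_ (hg p) measurable_const
  exact (MeasurableSet.const _).inter
    ((measurableSet_contactSet _ Torus.measurable_geometry_sepVec (N + 1) (hsDiameter σ N) p.1 p.2).preimage hY)

/-- The TRANSFER activity summand is a measurable functional of the record. -/
theorem measurable_impulse : Measurable (impulse : Rec N → ℝ) := by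
  unfold impulse
  exact (HardSphereCollisionRecord.measurable_postVel.fst.sub
    HardSphereCollisionRecord.measurable_preVel.fst).norm.add
    (((HardSphereCollisionRecord.measurable_postVel.fst.norm.pow_const 2).sub
      (HardSphereCollisionRecord.measurable_preVel.fst.norm.pow_const 2)).abs.div_const 2)

/-- **The closed running transfer activity at the `n`-th coin time is the coin sum over `m ≤ n`** (good `z`,
`n < coinCount`): coin decomposition of L1 and `#(0, coinTime n] = n + 1`. -/
theorem runAct_coinTime_eq_sum {τ : ℝ} (Φ : Flow σ N) {n : ℕ} {z : Phase N} (hz : z ∈ Φ.good)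
    (hn : n < coinCount σ τ Φ z) (i : Fin (N + 1)) :
    runAct σ τ Φ (coinTime Φ z n) i z = σ / τ * ∑ m ∈ Finset.range (n + 1),
      ∑ p ∈ contactPairs (Torus.geometry (Fin 3)) (hsDiameter σ N) (Φ.flow (coinTime Φ z m) z),
        if p.1 = i then impulse (HardSphereCollisionRecord.ofConfig (Torus.geometry (Fin 3)) (hsDiameter σ N)
          (Φ.flow (coinTime Φ z m) z) (coinTime Φ z m) p.1 p.2) else 0 := by
  rw [runAct, collisionSum_Ioc_eq_sum_range Φ hz, ncard_Ioc_coinTime Φ hz hn]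
  simp only [HardSphereCollisionRecord.ofConfig_fst]

/-- **The open running transfer activity at the `n`-th coin time is the coin sum over `m < n`** (good `z`,
`n < coinCount`). -/
theorem preAct_coinTime_eq_sum {τ : ℝ} (Φ : Flow σ N) {n : ℕ} {z : Phase N} (hz : z ∈ Φ.good)
    (hn : n < coinCount σ τ Φ z) (i : Fin (N + 1)) :
    preAct σ τ Φ (coinTime Φ z n) i z = σ / τ * ∑ m ∈ Finset.range n,
      ∑ p ∈ contactPairs (Torus.geometry (Fin 3)) (hsDiameter σ N) (Φ.flow (coinTime Φ z m) z),
        if p.1 = i then impulse (HardSphereCollisionRecord.ofConfig (Torus.geometry (Fin 3)) (hsDiameter σ N)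
          (Φ.flow (coinTime Φ z m) z) (coinTime Φ z m) p.1 p.2) else 0 := by
  rw [preAct, collisionSum_Ioo_coinTime_eq_sum_range Φ hz hn]
  simp only [HardSphereCollisionRecord.ofConfig_fst]

/-- On the guard event of the `n`-th coin, the closed running activity of `i` at the `n`-th coin time is measurable. -/
theorem measurable_runAct_coinTime_guard (hσ : 0 < σ) (hσ2 : σ < 1 / 2) (τ : ℝ) (Φ : Flow σ N) (n : ℕ)
    (i : Fin (N + 1)) :
    Measurable fun z : {z : Phase N // z ∈ Φ.good ∧ n < coinCount σ τ Φ z} => runAct σ τ Φ (coinTime Φ z.1 n) i z.1 := by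
  have heq : (fun z : {z : Phase N // z ∈ Φ.good ∧ n < coinCount σ τ Φ z} => runAct σ τ Φ (coinTime Φ z.1 n) i z.1) =
      fun z => σ / τ * ∑ m ∈ Finset.range (n + 1),
        ∑ p ∈ contactPairs (Torus.geometry (Fin 3)) (hsDiameter σ N) (Φ.flow (coinTime Φ z.1 m) z.1),
          if p.1 = i then impulse (HardSphereCollisionRecord.ofConfig (Torus.geometry (Fin 3)) (hsDiameter σ N)
            (Φ.flow (coinTime Φ z.1 m) z.1) (coinTime Φ z.1 m) p.1 p.2) else 0 :=
    funext fun z => runAct_coinTime_eq_sum Φ z.2.1 z.2.2 i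
  rw [heq]
  refine Measurable.const_mul (Finset.measurable_sum _ fun m hm => ?_) _
  have hmn : m ≤ n := Nat.lt_succ_iff.1 (Finset.mem_range.1 hm)
  refine measurable_sum_contactPairs_of_measurable (measurable_flow_coinTime_guard hσ hσ2 τ Φ hmn) fun p => ?_
  exact Measurable.ite (MeasurableSet.const _)
    (measurable_impulse.comp (measurable_record_guard hσ hσ2 τ Φ hmn p.1 p.2)) measurable_const

/-- On the guard event of the `n`-th coin, the open running activity of `i` at the `n`-th coin time is measurable. -/
theorem measurable_preAct_coinTime_guard (hσ : 0 < σ) (hσ2 : σ < 1 / 2) (τ : ℝ) (Φ : Flow σ N) (n : ℕ)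
    (i : Fin (N + 1)) :
    Measurable fun z : {z : Phase N // z ∈ Φ.good ∧ n < coinCount σ τ Φ z} => preAct σ τ Φ (coinTime Φ z.1 n) i z.1 := by
  have heq : (fun z : {z : Phase N // z ∈ Φ.good ∧ n < coinCount σ τ Φ z} => preAct σ τ Φ (coinTime Φ z.1 n) i z.1) =
      fun z => σ / τ * ∑ m ∈ Finset.range n,
        ∑ p ∈ contactPairs (Torus.geometry (Fin 3)) (hsDiameter σ N) (Φ.flow (coinTime Φ z.1 m) z.1),
          if p.1 = i then impulse (HardSphereCollisionRecord.ofConfig (Torus.geometry (Fin 3)) (hsDiameter σ N)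
            (Φ.flow (coinTime Φ z.1 m) z.1) (coinTime Φ z.1 m) p.1 p.2) else 0 :=
    funext fun z => preAct_coinTime_eq_sum Φ z.2.1 z.2.2 i
  rw [heq]
  refine Measurable.const_mul (Finset.measurable_sum _ fun m hm => ?_) _
  have hmn : m ≤ n := (Finset.mem_range.1 hm).le
  refine measurable_sum_contactPairs_of_measurable (measurable_flow_coinTime_guard hσ hσ2 τ Φ hmn) fun p => ?_
  exact Measurable.ite (MeasurableSet.const _)
    (measurable_impulse.comp (measurable_record_guard hσ hσ2 τ Φ hmn p.1 p.2)) measurable_const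

/-- On the guard event of the `n`-th coin, the ADAPTED clamp of `i` read at the `n`-th coin time is measurable. -/
theorem measurable_flagA_coinTime_guard (hσ : 0 < σ) (hσ2 : σ < 1 / 2) (τ V : ℝ) (Φ : Flow σ N) (n : ℕ)
    (i : Fin (N + 1)) :
    Measurable fun z : {z : Phase N // z ∈ Φ.good ∧ n < coinCount σ τ Φ z} =>
      flagA σ τ V Φ (coinTime Φ z.1 n) i z.1 := by
  unfold flagA
  exact Measurable.ite (measurableSet_le (measurable_runAct_coinTime_guard hσ hσ2 τ Φ n i) measurable_const)
    measurable_const measurable_const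

/-- On the guard event of the `n`-th coin, the PREDICTABLE clamp of `i` read at the `n`-th coin time is measurable. -/
theorem measurable_flagP_coinTime_guard (hσ : 0 < σ) (hσ2 : σ < 1 / 2) (τ V : ℝ) (Φ : Flow σ N) (n : ℕ)
    (i : Fin (N + 1)) :
    Measurable fun z : {z : Phase N // z ∈ Φ.good ∧ n < coinCount σ τ Φ z} =>
      flagP σ τ V Φ (coinTime Φ z.1 n) i z.1 := by
  unfold flagP
  exact Measurable.ite (measurableSet_le (measurable_preAct_coinTime_guard hσ hσ2 τ Φ n i) measurable_const)
    measurable_const measurable_const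

/-! ## L3 · guarded coin sums, marks and ranges are measurable -/

/-- A function defined by cases on a measurable event is measurable as soon as its restriction to the event is
(the other branch being a constant). -/
theorem measurable_ite_of_restrict {α β : Type*} [MeasurableSpace α] [MeasurableSpace β] {p : α → Prop}
    [DecidablePred p] (hp : MeasurableSet {a | p a}) {f : α → β} (hf : Measurable fun a : {a // p a} => f a.1)
    (c : β) : Measurable fun a => if p a then f a else c := by
  refine measurable_of_restrict_of_restrict_compl hp ?_ ?_
  · have heq : {a | p a}.restrict (fun a => if p a then f a else c) = fun a : {a // p a} => f a.1 :=
      funext fun a => if_pos a.2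
    rw [heq]
    exact hf
  · have heq : {a | p a}ᶜ.restrict (fun a => if p a then f a else c) = fun _ => c :=
      funext fun a => if_neg a.2
    rw [heq]
    exact measurable_const

open scoped Classical in
/-- **Guarded coin sums with ADAPTED clamps are measurable**: for every measurable functional `F` of the record,
`z ↦ 1{z ∈ good ∧ n < coinCount} Σ_{(i,j) at coin n} ω̃_i ω̃_j F(record)` is measurable in the datum. -/
theorem measurable_coinSumA (hσ : 0 < σ) (hσ2 : σ < 1 / 2) (τ V : ℝ) (Φ : Flow σ N) (n : ℕ) {F : Rec N → ℝ}
    (hF : Measurable F) :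
    Measurable fun z => if z ∈ Φ.good ∧ n < coinCount σ τ Φ z then
      ∑ p ∈ contactPairs (Torus.geometry (Fin 3)) (hsDiameter σ N) (Φ.flow (coinTime Φ z n) z),
        flagA σ τ V Φ (coinTime Φ z n) p.1 z * flagA σ τ V Φ (coinTime Φ z n) p.2 z *
          F (HardSphereCollisionRecord.ofConfig (Torus.geometry (Fin 3)) (hsDiameter σ N)
            (Φ.flow (coinTime Φ z n) z) (coinTime Φ z n) p.1 p.2) else 0 := by
  refine measurable_ite_of_restrict (measurableSet_coinGuard hσ hσ2 τ Φ n) ?_ 0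
  refine measurable_sum_contactPairs_of_measurable (measurable_flow_coinTime_guard hσ hσ2 τ Φ le_rfl) fun p => ?_
  exact ((measurable_flagA_coinTime_guard hσ hσ2 τ V Φ n p.1).mul
    (measurable_flagA_coinTime_guard hσ hσ2 τ V Φ n p.2)).mul
    (hF.comp (measurable_record_guard hσ hσ2 τ Φ le_rfl p.1 p.2))

open scoped Classical in
/-- **Guarded coin sums with PREDICTABLE clamps are measurable** (`ω̃⁻_i ω̃⁻_j` in place of `ω̃_i ω̃_j`). -/
theorem measurable_coinSumP (hσ : 0 < σ) (hσ2 : σ < 1 / 2) (τ V : ℝ) (Φ : Flow σ N) (n : ℕ) {F : Rec N → ℝ}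
    (hF : Measurable F) :
    Measurable fun z => if z ∈ Φ.good ∧ n < coinCount σ τ Φ z then
      ∑ p ∈ contactPairs (Torus.geometry (Fin 3)) (hsDiameter σ N) (Φ.flow (coinTime Φ z n) z),
        flagP σ τ V Φ (coinTime Φ z n) p.1 z * flagP σ τ V Φ (coinTime Φ z n) p.2 z *
          F (HardSphereCollisionRecord.ofConfig (Torus.geometry (Fin 3)) (hsDiameter σ N)
            (Φ.flow (coinTime Φ z n) z) (coinTime Φ z n) p.1 p.2) else 0 := by
  refine measurable_ite_of_restrict (measurableSet_coinGuard hσ hσ2 τ Φ n) ?_ 0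
  refine measurable_sum_contactPairs_of_measurable (measurable_flow_coinTime_guard hσ hσ2 τ Φ le_rfl) fun p => ?_
  exact ((measurable_flagP_coinTime_guard hσ hσ2 τ V Φ n p.1).mul
    (measurable_flagP_coinTime_guard hσ hσ2 τ V Φ n p.2)).mul
    (hF.comp (measurable_record_guard hσ hσ2 τ Φ le_rfl p.1 p.2))

/-- The row payloads are measurable functionals of the record (for measurable `φ`). -/
theorem measurable_payload {φ : T3 → ℝ} (hφ : Measurable φ) (r : Option (Fin 3)) :
    Measurable (payload φ r : Rec N → ℝ) := by
  have hdiff : Measurable fun c : Rec N => φ c.fstPos - φ c.sndPos :=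
    (hφ.comp HardSphereCollisionRecord.measurable_fstPos).sub (hφ.comp HardSphereCollisionRecord.measurable_sndPos)
  cases r with
  | none =>
    show Measurable fun c : Rec N => (φ c.fstPos - φ c.sndPos) * ((‖c.postVel.1‖ ^ 2 - ‖c.preVel.1‖ ^ 2) / 2)
    exact hdiff.mul (((HardSphereCollisionRecord.measurable_postVel.fst.norm.pow_const 2).sub
      (HardSphereCollisionRecord.measurable_preVel.fst.norm.pow_const 2)).div_const 2)
  | some k =>
    have hk : Measurable fun v : V3 => v k := (PiLp.continuous_apply 2 _ k).measurable
    show Measurable fun c : Rec N => (φ c.fstPos - φ c.sndPos) * (c.postVel.1 k - c.preVel.1 k)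
    exact hdiff.mul ((hk.comp HardSphereCollisionRecord.measurable_postVel.fst).sub
      (hk.comp HardSphereCollisionRecord.measurable_preVel.fst))

/-- The kinematic range bases are measurable functionals of the record. -/
theorem measurable_rangeBase (σ : ℝ) (N : ℕ) (r : Option (Fin 3)) : Measurable (rangeBase σ N r : Rec N → ℝ) := by
  have hg : Measurable fun c : Rec N => ‖c.preVel.1 - c.preVel.2‖ :=
    (HardSphereCollisionRecord.measurable_preVel.fst.sub HardSphereCollisionRecord.measurable_preVel.snd).norm
  cases r with
  | none =>
    show Measurable fun c : Rec N =>
      hsDiameter σ N * (‖c.preVel.1 - c.preVel.2‖ * ((2 : ℝ)⁻¹ * ‖c.preVel.1 + c.preVel.2‖))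
    exact (hg.mul ((HardSphereCollisionRecord.measurable_preVel.fst.add
      HardSphereCollisionRecord.measurable_preVel.snd).norm.const_mul _)).const_mul _
  | some k =>
    show Measurable fun c : Rec N => hsDiameter σ N * ‖c.preVel.1 - c.preVel.2‖
    exact hg.const_mul _

open scoped Classical in
/-- **The mark is a guarded coin sum with adapted clamps** (its definition, with the record's time and labels
evaluated: `c.time = coinTime n`, `c.fst = p.1`, `c.snd = p.2`). -/
theorem coinMark_eq_ite (τ V : ℝ) (φ : T3 → ℝ) (Φ : Flow σ N) (r : Option (Fin 3)) (n : ℕ) :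
    coinMark σ τ V φ Φ r n = fun z => if z ∈ Φ.good ∧ n < coinCount σ τ Φ z then
      ∑ p ∈ contactPairs (Torus.geometry (Fin 3)) (hsDiameter σ N) (Φ.flow (coinTime Φ z n) z),
        flagA σ τ V Φ (coinTime Φ z n) p.1 z * flagA σ τ V Φ (coinTime Φ z n) p.2 z *
          (payload φ r (HardSphereCollisionRecord.ofConfig (Torus.geometry (Fin 3)) (hsDiameter σ N)
            (Φ.flow (coinTime Φ z n) z) (coinTime Φ z n) p.1 p.2) / 2) else 0 := by
  funext z
  unfold coinMark
  split_ifs with h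
  · refine Finset.sum_congr rfl fun p _ => ?_
    simp only [HardSphereCollisionRecord.ofConfig_time, HardSphereCollisionRecord.ofConfig_fst,
      HardSphereCollisionRecord.ofConfig_snd]
    ring
  · rfl

open scoped Classical in
/-- **The truncated predictable range is a guarded coin sum with predictable clamps.** -/
theorem coinRange_eq_ite (τ V : ℝ) (Φ : Flow σ N) (r : Option (Fin 3)) (n : ℕ) :
    coinRange σ τ V Φ r n = fun z => if z ∈ Φ.good ∧ n < coinCount σ τ Φ z then
      ∑ p ∈ contactPairs (Torus.geometry (Fin 3)) (hsDiameter σ N) (Φ.flow (coinTime Φ z n) z),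
        flagP σ τ V Φ (coinTime Φ z n) p.1 z * flagP σ τ V Φ (coinTime Φ z n) p.2 z *
          (min (rangeBase σ N r (HardSphereCollisionRecord.ofConfig (Torus.geometry (Fin 3)) (hsDiameter σ N)
            (Φ.flow (coinTime Φ z n) z) (coinTime Φ z n) p.1 p.2)) (window τ N * V) / 2) else 0 := by
  funext z
  unfold coinRange
  split_ifs with h
  · refine Finset.sum_congr rfl fun p _ => ?_
    simp only [HardSphereCollisionRecord.ofConfig_time, HardSphereCollisionRecord.ofConfig_fst,
      HardSphereCollisionRecord.ofConfig_snd]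
    ring
  · rfl

/-- **L3a · the coin marks are measurable in the datum** (registered sub-goal of `stub_compensatorDefectLD`). -/
theorem compensatorDefect_coinMark_measurable {σ : ℝ} (hσ : 0 < σ) (hσ2 : σ < 1 / 2) (τ V : ℝ) {φ : T3 → ℝ}
    (hφ : Measurable φ) (N : ℕ) (Φ : Flow σ N) (r : Option (Fin 3)) (n : ℕ) :
    Measurable (coinMark σ τ V φ Φ r n) := by
  rw [coinMark_eq_ite]
  exact measurable_coinSumA hσ hσ2 τ V Φ n (F := fun c => payload φ r c / 2) ((measurable_payload hφ r).div_const 2)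

/-- **L3b · the truncated predictable ranges are measurable in the datum** (registered sub-goal of
`stub_compensatorDefectLD`). -/
theorem compensatorDefect_coinRange_measurable {σ : ℝ} (hσ : 0 < σ) (hσ2 : σ < 1 / 2) (τ V : ℝ) (N : ℕ)
    (Φ : Flow σ N) (r : Option (Fin 3)) (n : ℕ) : Measurable (coinRange σ τ V Φ r n) := by
  rw [coinRange_eq_ite]
  exact measurable_coinSumP hσ hσ2 τ V Φ n (F := fun c => min (rangeBase σ N r c) (window τ N * V) / 2)
    (((measurable_rangeBase σ N r).min measurable_const).div_const 2)

/-! ## L4 · the natural coin filtration -/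

/-- **L4 · a filtration of phase space carrying the marks (adapted) and the ranges (predictable)** — the first two
conjuncts of `stub_compensatorDefectLD`, witnessed by the natural coin filtration
`ℱ n = σ(coinRange … r m, m ≤ n; coinMark … r m, m < n)` (registered sub-goal). -/
theorem compensatorDefect_coinFiltration_exists {σ : ℝ} (hσ : 0 < σ) (hσ2 : σ < 1 / 2) (τ V : ℝ) {φ : T3 → ℝ}
    (hφ : Measurable φ) (N : ℕ) (Φ : Flow σ N) :
    ∃ ℱ : Filtration ℕ (inferInstance : MeasurableSpace (Phase N)),
      (∀ (r : Option (Fin 3)) (n : ℕ), StronglyMeasurable[ℱ (n + 1)] (coinMark σ τ V φ Φ r n)) ∧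
      ∀ (r : Option (Fin 3)) (n : ℕ), StronglyMeasurable[ℱ n] (coinRange σ τ V Φ r n) := by
  refine ⟨⟨fun n => (⨆ (m : ℕ) (_ : m ≤ n), ⨆ r : Option (Fin 3),
      MeasurableSpace.comap (coinRange σ τ V Φ r m) inferInstance) ⊔
    ⨆ (m : ℕ) (_ : m < n), ⨆ r : Option (Fin 3), MeasurableSpace.comap (coinMark σ τ V φ Φ r m) inferInstance,
    fun _ _ hnn' => sup_le_sup (biSup_mono fun _ hm => hm.trans hnn') (biSup_mono fun _ hm => lt_of_lt_of_le hm hnn'),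
    fun _ => sup_le
      (iSup₂_le fun m _ => iSup_le fun r => (compensatorDefect_coinRange_measurable hσ hσ2 τ V N Φ r m).comap_le)
      (iSup₂_le fun m _ => iSup_le fun r =>
        (compensatorDefect_coinMark_measurable hσ hσ2 τ V hφ N Φ r m).comap_le)⟩, fun r n => ?_, fun r n => ?_⟩
  · refine (Measurable.mono (comap_measurable (coinMark σ τ V φ Φ r n)) ?_ le_rfl).stronglyMeasurable
    exact le_sup_of_le_right (le_iSup₂_of_le n n.lt_succ_self (le_iSup (fun r : Option (Fin 3) =>
      MeasurableSpace.comap (coinMark σ τ V φ Φ r n) (inferInstance : MeasurableSpace ℝ)) r))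
  · refine (Measurable.mono (comap_measurable (coinRange σ τ V Φ r n)) ?_ le_rfl).stronglyMeasurable
    exact le_sup_of_le_left (le_iSup₂_of_le n le_rfl (le_iSup (fun r : Option (Fin 3) =>
      MeasurableSpace.comap (coinRange σ τ V Φ r n) (inferInstance : MeasurableSpace ℝ)) r))

end Summit.AtomisticToContinuum.HydrodynamicLimit.Theorems.ClampedTransferCoin

end
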